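import Literature.AlgebraicGeometry.Surfaces.K3RealMultiplicationCycleInduced
import HarnessLib

/-!
# Existence of K3 surfaces with real multiplication by prescribed totally real fields
# (van Geemen–Schütt 2025, §3)

Family `hodge`, layer `Literature/AlgebraicGeometry/Surfaces`; the K3-SURFACE-level existence half of
real multiplication, which `Motives/HodgeStructureK3RealMult` ("the existence half of Lemma 3.2 … the
K3-surface layer … K3 surfaces with real multiplication") lists as not vendored. Source: B. van Geemen,
M. Schütt, *On families of K3 surfaces with real multiplication*, Forum Math. Sigma 13 (2025) e2 =
arXiv:2310.05196v2, §§2–3 (held as `paper:arxiv-2310.05196`; numbering checked on the arXiv v2 HTML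
rendering). Vocabulary of `Surfaces/K3RealMultiplicationCycleInduced` (same paper, §§4–7).

Printed statements (`F = End_Hdg(T_{X,ℚ})`, `d = dim_ℚ T_{X,ℚ} = 22 - ρ`, `m = [F:ℚ]`,
`l = d/m = dim_F T_{X,ℚ}`; "a family of K3 surfaces has RM by `F` if the very general member `X`
has `F = End_Hdg(T_{X,ℚ})`", §1):

* §2.4–2.6 (after van Geemen 2008): in the RM case `l ≥ 3` (Lemma 2.5), hence `ρ(X) ≤ 16`, the
  deformation space of K3 surfaces with given `F`-action has dimension `l - 2 ≥ 1`, "a K3 surface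
  with RM is not isolated in moduli"; `d ≤ 21` forces `m ≤ 7` (§2.7). (The non-existence half is
  the tree's PROVED `Motives.HodgeStructure.Vangeemen2008_three_mul_finrank_endAlg_le`.)
* **Thm. 3.5**: "Let `F` be a totally real field of degree `1 < d ≤ 5`. Let `l = ⌊20/d⌋` for
  `d ≠ 4` resp. `l = 4` for `d = 4`. Then there is an `l - 2`-dimensional family of K3 surfaces with
  RM by `F`." (Proof: embed `F` in the CM field `E = FK`, `K` CM of degree `l` with `K ∩ F = ℚ`;
  Taelman gives a K3 surface with `E = End_Hdg(T_{X,ℚ})`, `dim_E T = 1`, so `dim_F T = l ≥ 4`;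
  deform by Prop. 3.2, which preserves `T_X` and `Pic(X)` up to isometry for the very general
  member.) Hence very general Picard number `ρ = 22 - dl`: `2, 4, 6, 2` for `d = 2, 3, 4, 5`.
* **Thm. 3.10**: "For any squarefree `d > 0` and any `r > 0`, there is an 8-dimensional family of K3
  surfaces with a genus one fibration such that the very general member `X` has `Pic(X) ≅ U(r)`
  and has RM by `ℚ(√d)`." (`T_X = U ⊕ U(r) ⊕ E₈²`; the `ℚ(√d)`-action `(u,v) ↦ (dv,u)`, `M² = d`.)
* **Thm. 3.14**: "Let `F` be a totally real cyclic cubic field with class number one. Then there is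
  a 7-dimensional family of K3 surfaces with RM by `F`." (Proof: `X` of Picard rank one with
  `h² = k²`, `T_{X,ℚ} ≅ ⟨1⟩² ⊕ ⟨-1⟩¹⁹ ≅ (F, b_{uδ})² ⊕ (F, b_δ)⁵` with the diagonal `F`-action, the
  different being principal and `F` of full unit signature rank; `l = 7`, `ρ = 1`.)

## Lean rendering

As in `K3RealMultiplicationCycleInduced`, members of families cannot be named in the tree; each
theorem is typed as the EXISTENCE of a (very general) member: a K3 surface `S` with the printed very
general Picard number, not of CM type, and a rational Hodge endomorphism `t` of `H²(S(ℂ); ℂ)`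
vanishing on `N = algebraicClasses S 1` with image in `T = N^⊥` such that `P(t) = 0` on `T` and
`End_Hdg(T_{S,ℚ}) = ℚ[t|_T]` (`IsRealMultiplicationK3 S ρ P`). "RM by the totally real field `F`" is
rendered through a primitive element: `F ≅ ℚ[X]/(P)` with `P` irreducible; for Thm. 3.5 the field is
quantified AS its minimal polynomial — `P ∈ ℚ[X]` irreducible of degree `d` with only real roots
(`(P.map (algebraMap ℚ ℝ)).Splits`), which is exactly "`ℚ[X]/(P)` is a totally real field of degree
`d`"; for Thm. 3.14 the field `F` is a Mathlib number field (`IsGalois ℚ F`, `finrank ℚ F = 3` — a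
Galois cubic is cyclic — `NumberField.classNumber F = 1`, `NumberField.IsTotallyReal F`) and `P` is
the minimal polynomial of any primitive element `θ`. Not rendered (recorded gaps, not weakenings of
what IS stated): the dimensions of the families; in Thm. 3.10 the lattice `Pic(X) ≅ U(r)` and the
genus one fibration (only `ρ = 2` is kept; TODO(general form)); Prop. 3.2 (RM deformations of a CM K3
surface with `dim_E T ≥ 2`), Prop. 3.7 and Thm. 3.18 (fields `F_m`, `m = 4, 6, 7`, given by a table of
polynomials).

## References

* [GeemenSchutt2023] B. van Geemen, M. Schütt, On families of K3 surfaces with real multiplication,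
  Forum Math. Sigma 13 (2025) e2, arXiv:2310.05196: §1, §2.4–2.7, Prop. 3.2, Thm. 3.5, Prop. 3.7,
  Thm. 3.10, Thm. 3.14, Rem. 3.16, Thm. 3.18.
* [Vangeemen2008] B. van Geemen, Real multiplication on K3 surfaces and Kuga–Satake varieties,
  Michigan Math. J. 56 (2008), Lemma 3.2, §3.4.
* [Zarhin1983HodgeGroupsK3] Yu. G. Zarhin, Hodge groups of K3 surfaces, J. reine angew. Math. 341
  (1983), Thm. 1.5.1.
-/

noncomputable section

open CategoryTheory MonoidalCategory Polynomial
open Literature.AlgebraicTopology.SingularHomology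
open Literature.AlgebraicGeometry.HodgeTheory

namespace Literature.AlgebraicGeometry.Surfaces

variable {S : Motives.SchemeOver ℂ}

/-- **A K3 surface of Picard number `ρ` with real multiplication by `ℚ[X]/(P)`**: `S` is a K3
surface with `dim_ℂ N¹H²(S(ℂ); ℂ) = ρ`, NOT of CM type (`End_Hdg(T_{S,ℚ})` totally real), carrying a
`ℂ`-linear endomorphism `t` of `H²(S(ℂ); ℂ)` preserving rational classes and Hodge types, vanishing on
`N = algebraicClasses S 1`, with image cup-orthogonal to `N`, such that `P(t) = 0` on `T = N^⊥`
(`IsAnnihilatedOnTranscendentalBy`) and every rational Hodge endomorphism of `T` extended by `0` is a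
rational polynomial in `t` (`TranscendentalEndomorphismsGeneratedBy`: `End_Hdg(T_{S,ℚ}) = ℚ[t|_T]`,
`≅ ℚ[X]/(P)` for `P` irreducible). "RM by `F`": `F = End_Hdg(T_{X,ℚ})` totally real, `F ≠ ℚ`.
[cite: GeemenSchutt2023, §1 and §2.1, §2.4] [cite: Zarhin1983HodgeGroupsK3, Thm. 1.5.1] -/
def IsRealMultiplicationK3 (S : Motives.SchemeOver ℂ) (ρ : ℕ) (P : ℚ[X]) : Prop :=
  IsK3Surface S ∧ Module.finrank ℂ ↥(algebraicClasses S 1) = ρ ∧ ¬ HasComplexMultiplication S ∧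
    ∃ t : complexBetti S (2 * 1) →ₗ[ℂ] complexBetti S (2 * 1),
      (∀ y, IsRationalClass y → IsRationalClass (t y)) ∧
      (∀ (i j : ℕ) (y : complexBetti S (2 * 1)),
          IsOfHodgeType 2 S (2 * 1) i j y → IsOfHodgeType 2 S (2 * 1) i j (t y)) ∧
      (∀ d ∈ algebraicClasses S 1, t d = 0) ∧
      (∀ (y : complexBetti S (2 * 1)), ∀ d ∈ algebraicClasses S 1,
          cupProduct (rfl : 2 * 1 + 2 * 1 = 2 * 2) (t y) d = 0) ∧
      IsAnnihilatedOnTranscendentalBy S t P ∧ TranscendentalEndomorphismsGeneratedBy S t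

/-- Unfolding of `IsRealMultiplicationK3`. [cite: GeemenSchutt2023, §2.1] -/
theorem isRealMultiplicationK3_iff (S : Motives.SchemeOver ℂ) (ρ : ℕ) (P : ℚ[X]) :
    IsRealMultiplicationK3 S ρ P ↔
      IsK3Surface S ∧ Module.finrank ℂ ↥(algebraicClasses S 1) = ρ ∧ ¬ HasComplexMultiplication S ∧
        ∃ t : complexBetti S (2 * 1) →ₗ[ℂ] complexBetti S (2 * 1),
          (∀ y, IsRationalClass y → IsRationalClass (t y)) ∧
          (∀ (i j : ℕ) (y : complexBetti S (2 * 1)),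
              IsOfHodgeType 2 S (2 * 1) i j y → IsOfHodgeType 2 S (2 * 1) i j (t y)) ∧
          (∀ d ∈ algebraicClasses S 1, t d = 0) ∧
          (∀ (y : complexBetti S (2 * 1)), ∀ d ∈ algebraicClasses S 1,
              cupProduct (rfl : 2 * 1 + 2 * 1 = 2 * 2) (t y) d = 0) ∧
          IsAnnihilatedOnTranscendentalBy S t P ∧ TranscendentalEndomorphismsGeneratedBy S t :=
  Iff.rfl

namespace IsRealMultiplicationK3

variable {ρ : ℕ} {P : ℚ[X]}

/-- An RM K3 surface is a K3 surface. [cite: GeemenSchutt2023, §2.1] -/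
theorem isK3Surface (h : IsRealMultiplicationK3 S ρ P) : IsK3Surface S :=
  h.1

/-- … of Picard number `ρ`. [cite: GeemenSchutt2023, §2.1] -/
theorem finrank_algebraicClasses_one (h : IsRealMultiplicationK3 S ρ P) :
    Module.finrank ℂ ↥(algebraicClasses S 1) = ρ :=
  h.2.1

/-- … not of CM type. [cite: GeemenSchutt2023, §2.1] -/
theorem not_hasComplexMultiplication (h : IsRealMultiplicationK3 S ρ P) :
    ¬ HasComplexMultiplication S :=
  h.2.2.1

end IsRealMultiplicationK3

/-- A K3 surface whose real multiplication is cycle-induced (`IsCycleInducedRMK3`, §§4–7 of the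
paper) is in particular an RM K3 surface in the sense above (forget the algebraic cycle).
[cite: GeemenSchutt2023, §4.8] -/
theorem IsCycleInducedRMK3.isRealMultiplicationK3 {ρ : ℕ} {P : ℚ[X]} (h : IsCycleInducedRMK3 S ρ P) :
    IsRealMultiplicationK3 S ρ P := by
  obtain ⟨hS, hρ, hCM, t, ⟨hrat, htyp, hN, hperp, -⟩, hP, hgen⟩ := h
  exact ⟨hS, hρ, hCM, t, hrat, htyp, hN, hperp, hP, hgen⟩

/-- The very general Picard number `22 - d·l` of Thm. 3.5 (`l = ⌊20/d⌋` for `d ≠ 4`, `l = 4` for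
`d = 4`): `ρ = 2, 4, 6, 2` for `d = 2, 3, 4, 5` (and `0` off this range, unused).
[cite: GeemenSchutt2023, Thm. 3.5] -/
def vanGeemenSchuettPicardNumber (d : ℕ) : ℕ :=
  if d = 2 then 2 else if d = 3 then 4 else if d = 4 then 6 else if d = 5 then 2 else 0

/-- `ρ(2) = 22 - 2·10 = 2`. [cite: GeemenSchutt2023, Thm. 3.5] -/
theorem vanGeemenSchuettPicardNumber_two : vanGeemenSchuettPicardNumber 2 = 22 - 2 * (20 / 2) := by
  decide

/-- `ρ(3) = 22 - 3·6 = 4`. [cite: GeemenSchutt2023, Thm. 3.5] -/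
theorem vanGeemenSchuettPicardNumber_three : vanGeemenSchuettPicardNumber 3 = 22 - 3 * (20 / 3) := by
  decide

/-- `ρ(4) = 22 - 4·4 = 6`. [cite: GeemenSchutt2023, Thm. 3.5] -/
theorem vanGeemenSchuettPicardNumber_four : vanGeemenSchuettPicardNumber 4 = 22 - 4 * 4 := by
  decide

/-- `ρ(5) = 22 - 5·4 = 2`. [cite: GeemenSchutt2023, Thm. 3.5] -/
theorem vanGeemenSchuettPicardNumber_five : vanGeemenSchuettPicardNumber 5 = 22 - 5 * (20 / 5) := by
  decide

/-- **van Geemen–Schütt, Thm. 3.5: every totally real field of degree `2 ≤ d ≤ 5` is the endomorphism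
field of the transcendental Hodge structure of a K3 surface.** "Let `F` be a totally real field of
degree `1 < d ≤ 5`. Let `l = ⌊20/d⌋` for `d ≠ 4` resp. `l = 4` for `d = 4`. Then there is an
`l - 2`-dimensional family of K3 surfaces with RM by `F`" (very general member: `F = End_Hdg(T_{X,ℚ})`,
`dim_F T = l`, `ρ = 22 - dl`; proof via Taelman's CM K3 surfaces and the RM deformations of
Prop. 3.2). Rendering: the field is given by the minimal polynomial `P` of a primitive element —
`P ∈ ℚ[X]` irreducible of degree `d` all of whose complex roots are real — and the conclusion is the
existence of a K3 surface with `IsRealMultiplicationK3 S (22 - dl) P` (`ρ = 2, 4, 6, 2`); the family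
and its dimension are not rendered. [cite: GeemenSchutt2023, Thm. 3.5, Prop. 3.2, §3.4] -/
def VanGeemenSchuett2025_exists_rmK3_totallyReal_degree_le_five : Prop :=
  ∀ (P : ℚ[X]) (d : ℕ), Irreducible P → P.natDegree = d → 2 ≤ d → d ≤ 5 →
    (P.map (algebraMap ℚ ℝ)).Splits →
      ∃ S : Motives.SchemeOver ℂ, IsRealMultiplicationK3 S (vanGeemenSchuettPicardNumber d) P

/-- **van Geemen–Schütt, Thm. 3.10: K3 surfaces of Picard number `2` with real multiplication by any
real quadratic field.** "For any squarefree `d > 0` and any `r > 0`, there is an 8-dimensional family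
of K3 surfaces with a genus one fibration such that the very general member `X` has
`Pic(X) ≅ U(r)` and has RM by `ℚ(√d)`" (`T_X = U ⊕ U(r) ⊕ E₈²` with the `ℚ(√d)`-action `(u, v) ↦ (dv, u)`,
`M² = d`; surjectivity of the period map and Torelli). Rendering: for squarefree `d > 1` there is a
K3 surface with `IsRealMultiplicationK3 S 2 (X² - d)`; the lattice `Pic ≅ U(r)`, the genus one
fibration and the dimension `8` are not rendered. [cite: GeemenSchutt2023, Thm. 3.10] -/
def VanGeemenSchuett2025_exists_rmK3_realQuadratic_picardTwo : Prop :=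
  ∀ d : ℕ, Squarefree d → 1 < d →
    ∃ S : Motives.SchemeOver ℂ, IsRealMultiplicationK3 S 2 (X ^ 2 - C (d : ℚ))

/-- **van Geemen–Schütt, Thm. 3.14: K3 surfaces of Picard number `1` with real multiplication by any
totally real cyclic cubic field of class number one.** "Let `F` be a totally real cyclic cubic field
with class number one. Then there is a […] family of K3 surfaces with RM by `F`" (proof: `X` of
Picard rank one with `h² = k²`, `T_{X,ℚ} ≅ ⟨1⟩² ⊕ ⟨-1⟩¹⁹ ≅ (F, b_{uδ})² ⊕ (F, b_δ)⁵`, `δ` a generator of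
the (principal) different, `u` a unit adjusting the signature — full unit signature rank; `l = 7`,
`ρ = 1`). Rendering: `F` a number field, Galois over `ℚ` of degree `3` (a Galois cubic is cyclic),
totally real, of class number one; for every primitive element `θ` (`deg minpoly = 3`) there is a K3
surface with `IsRealMultiplicationK3 S 1 (minpoly ℚ θ)`. [cite: GeemenSchutt2023, Thm. 3.14, Rem. 3.16, Example 3.17] -/
def VanGeemenSchuett2025_exists_rmK3_cyclicCubic_picardOne : Prop :=
  ∀ (F : Type) [Field F] [NumberField F] [NumberField.IsTotallyReal F] [IsGalois ℚ F],
    Module.finrank ℚ F = 3 → NumberField.classNumber F = 1 →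
      ∀ θ : F, (minpoly ℚ θ).natDegree = 3 →
        ∃ S : Motives.SchemeOver ℂ, IsRealMultiplicationK3 S 1 (minpoly ℚ θ)

end Literature.AlgebraicGeometry.Surfaces

end
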